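import Literature.AlgebraicGeometry.GroupSchemes.AffineGroupSchemeHopfAlgebra
import Mathlib.AlgebraicGeometry.AlgClosed.Basic
import Mathlib.AlgebraicGeometry.Morphisms.Etale
import Mathlib.AlgebraicGeometry.Morphisms.FlatRank
import Mathlib.CategoryTheory.Monoidal.Cartesian.Grp
import Mathlib.RingTheory.Spectrum.Prime.Noetherian
import HarnessLib

/-!
# A finite group scheme over an algebraically closed field with trivial unit component is étale

Topic `Literature/AlgebraicGeometry/GroupSchemes`; namespace `Literature.AlgebraicGeometry.GroupSchemes`.
THEOREMS ONLY (no definition, no named fact, no instance, no notation, no `sorry`).  Cell `hodgecm-mathlib`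
(D-0151), FLOOR 0, P6 «MOD programme», organ **(b1f) «TRIVIAL UNIT COMPONENT ⇒ ÉTALE»** dealt by desk
F0P6b-plan (g0) (2026-09-01T13:52:57Z) for the P6b sub-line `F0_P6b_ConnectedEtale` (socket-to-be
`stub_b1f_etaleOfTrivialUnitComponent`) and the input of DICT letter (b) `eq_kerF_or_isEtale` over `κ̄`
(«`H⁰ = 1 ⇒ H` étale»).  HC_CM is proved only modulo the printed citations until rung 0 closes; this file is
generic algebraic geometry and changes no count.

THE PRINT.  [Tate1997FiniteFlatGroupSchemes] (3.7): for a finite group scheme `G` over a henselian local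
base the connected component `G⁰` of the unit is an open and closed subgroup scheme, and translations by
rational points permute the connected components; over an algebraically closed field `k` every point is
rational, so `G = ⊔_{g ∈ G(k)} g·G⁰`, and `G⁰ = Spec k` forces `G ≅ ⊔_{G(k)} Spec k`, the constant (étale)
group scheme with `|G(k)| = rank G` (cf. Mumford, *Abelian Varieties*, §11 and §14, on finite group
schemes over `k = k̄`: `G` is étale iff `G⁰` is trivial, and étale ones are constant; [StacksProject]
Tag 00U3 for `#Hom_k(Γ, k) = dim_k Γ` of an étale = split `k`-algebra).

PROOF ROUTE «translation automorphisms of the SCHEME» (no Hopf algebra): (§1) for a group object `G` of a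
cartesian monoidal category and a point `g : 𝟙 ⟶ G`, left translation `τ_g := (toUnit ≫ g) * 𝟙_G` (product
in Mathlib's group `Hom(G, G)`) is an automorphism of the OBJECT `G` with `η ≫ τ_g = g`
(`exists_iso_one_comp_eq`); (§2) hence if the unit section `η.left : Spec k → G` is an OPEN IMMERSION, so
is every `k`-point `g.left = η.left ≫ τ_g.left` (`isOpenImmersion_left_of_isOpenImmersion_one_left`); a finite
`k`-scheme has closed points only (`isClosed_singleton_of_isFinite`, Artinian coordinate ring) and over
`k = k̄` every closed point carries a `k`-point (Mathlib `pointOfClosedPoint`), so the `k`-points form an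
OPEN COVER of `G` by copies of `Spec k` on each of which the structure map is an isomorphism — `G → Spec k`
is étale, étaleness being Zariski-local on the source (`etale_of_isOpenImmersion_one_left`); the count
`|G(k)| = dim_k Γ(G, 𝒪)` is then ★ `Motives.natCard_specHom_eq_finrank` (`natCard_hom_eq_finrank_of_etale`).
(§3) A unit component `j : G₀ ↪ G` in the sense of the P6b line (`IsMonHom j`, `j.left` an open and closed
immersion, `G₀.left` connected) with `G₀ → Spec k` an ISOMORPHISM makes the unit section an open immersion
(`η[G] = η[G₀] ≫ j`), whence the headline `etale_and_natCard_eq_of_isUnitComponent_of_isIso` (the four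
`IsUnitComponent` clauses are spelled out, so that this file does not import the Lines workfile).

(§4, ED. 2) RANK-ONE FORM: the hypothesis `IsIso G₀.hom` in the currency of the P6b count `stub_b1cg` —
`eB₀ : G₀.left ≅ Spec B₀` over `k` with `dim_k B₀ = 1` (`isIso_hom_of_finrank_eq_one`, Mathlib
`Scheme.Hom.isIso_iff_finrank_eq`) — `etale_and_natCard_eq_of_isUnitComponent_of_finrank_eq_one`.

(§5, ED. 3) ONE POINT ⟹ CONNECTED (organ μ3): `connectedSpace_left_of_natCard_hom_eq_one` — a finite
`k`-scheme, `k = k̄`, with exactly one `k`-point has connected (one-point) underlying space.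

FALSE VARIANTS (why the hypotheses): over a non-algebraically-closed field the étale conclusion still holds
but the count `|G(k)| = rank` fails (non-rational points: `μ₃` over `ℚ`); without `G₀ ≅ Spec k` nothing is
étale (`α_p`, `μ_p` in characteristic `p` are connected with `G = G⁰`).
-/

universe v u

open CategoryTheory CategoryTheory.Limits AlgebraicGeometry MonoidalCategory CartesianMonoidalCategory
open scoped MonObj

namespace Literature.AlgebraicGeometry.GroupSchemes

/-! ## §1 Translations by points are automorphisms of the underlying object -/

section Translation

variable {C : Type u} [Category.{v} C] [CartesianMonoidalCategory C] (G : C) [GrpObj G]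

/-- **Left translation by a point is an automorphism.** For a group object `G` of a cartesian monoidal
category and a point `g : 𝟙 ⟶ G` there is an isomorphism `τ : G ≅ G` of the underlying OBJECT (not a
homomorphism) with `η ≫ τ.hom = g`: `τ.hom = (toUnit G ≫ g) * 𝟙 G` in the group `Hom(G, G)` (pointwise:
`x ↦ g·x`), with inverse `(toUnit G ≫ g)⁻¹ * 𝟙 G`.  This is «translations permute the points ∕ components»
of [Tate1997FiniteFlatGroupSchemes] (3.7). [cite: Tate1997FiniteFlatGroupSchemes, (3.7)] -/
theorem exists_iso_one_comp_eq (g : 𝟙_ C ⟶ G) : ∃ τ : G ≅ G, η[G] ≫ τ.hom = g := by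
  -- the constant map `G → 𝟙 → G` at `g`, as an element of the group `Hom(G, G)`
  set a : G ⟶ G := toUnit G ≫ g with ha
  have hinv : a⁻¹ = toUnit G ≫ (g ≫ ι[G]) := by
    rw [Hom.inv_def, ha, Category.assoc]
  have key : ∀ b : G ⟶ G, (b * 𝟙 G) ≫ a = a ∧ (b * 𝟙 G) ≫ a⁻¹ = a⁻¹ := fun b =>
    ⟨by rw [ha, comp_toUnit_assoc], by rw [hinv, comp_toUnit_assoc]⟩
  refine ⟨⟨a * 𝟙 G, a⁻¹ * 𝟙 G, ?_, ?_⟩, ?_⟩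
  · rw [MonObj.comp_mul, (key a).2, Category.comp_id, ← mul_assoc, inv_mul_cancel, one_mul]
  · rw [MonObj.comp_mul, (key a⁻¹).1, Category.comp_id, ← mul_assoc, mul_inv_cancel, one_mul]
  · change η[G] ≫ (a * 𝟙 G) = g
    rw [MonObj.comp_mul, Category.comp_id, ha, ← Category.assoc, toUnit_unique (η[G] ≫ toUnit G) (𝟙 _),
      Category.id_comp, MonObj.one_eq_one, mul_one]

/-- For a group SCHEME `G` over `S` (a group object of `Over S`) the translation automorphism is an isomorphism
of the underlying schemes over `S`: for `g : 𝟙 ⟶ G` there is `τ : G.left ≅ G.left` with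
`η.left ≫ τ.hom = g.left` and `τ.hom ≫ G.hom = G.hom`. [cite: Tate1997FiniteFlatGroupSchemes, (3.7)] -/
theorem exists_iso_left_one_comp_eq {S : Scheme.{u}} (G : Over S) [GrpObj G] (g : 𝟙_ (Over S) ⟶ G) :
    ∃ τ : G.left ≅ G.left, (η[G] : 𝟙_ (Over S) ⟶ G).left ≫ τ.hom = g.left ∧ τ.hom ≫ G.hom = G.hom := by
  obtain ⟨τ, hτ⟩ := exists_iso_one_comp_eq G g
  exact ⟨(Over.forget S).mapIso τ, by rw [← hτ]; rfl, Over.w τ.hom⟩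

end Translation

/-! ## §2 Finite group schemes over `k = k̄` whose unit section is an open immersion are étale -/

section Field

variable {k : Type u} [Field k]

/-- A scheme FINITE over a field has only closed points: its coordinate ring is an Artin ring, in which
every prime ideal is maximal and there are finitely many of them, so its spectrum is finite discrete
([AtiyahMacdonald1969] Prop. 8.1 «In an Artin ring A every prime ideal is maximal», Prop. 8.3 «An Artin ring
has only a finite number of maximal ideals»; Mathlib `DiscreteTopology (PrimeSpectrum R)` for Artinian `R`).
[cite: AtiyahMacdonald1969, Prop. 8.1 and Prop. 8.3 (p. 89)] -/
theorem isClosed_singleton_of_isFinite {X : Scheme.{u}} (f : X ⟶ Spec (.of k)) [IsFinite f] (x : X) :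
    IsClosed ({x} : Set X) := by
  haveI : IsAffine X := isAffine_of_isAffineHom f
  letI := (Motives.algebraMapΓ f).hom.toAlgebra
  haveI : IsFinite (Over.mk f : Over (Spec (.of k))).hom := inferInstanceAs (IsFinite f)
  haveI : Module.Finite k Γ(X, ⊤) := AffineGroupScheme.Alg.moduleFinite (Over.mk f)
  haveI : IsArtinianRing Γ(X, ⊤) := IsArtinianRing.of_finite k Γ(X, ⊤)
  haveI : DiscreteTopology ↥(Spec Γ(X, ⊤)) := inferInstanceAs (DiscreteTopology (PrimeSpectrum Γ(X, ⊤)))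
  haveI : DiscreteTopology ↥X :=
    (X.isoSpec.hom.homeomorph.isEmbedding).discreteTopology
  exact isClosed_discrete _

variable (G : Over (Spec (.of k)))

/-- Over an algebraically closed field, every point of a FINITE `k`-scheme `G` is the image of a `k`-point
`g : 𝟙 ⟶ G` (all points are closed and closed points of a scheme locally of finite type over `k = k̄` are
rational, Mathlib `pointOfClosedPoint`). [cite: Tate1997FiniteFlatGroupSchemes, (3.7)] [cite: StacksProject, Tag 00U3] -/
theorem exists_hom_left_apply_eq [IsAlgClosed k] [IsFinite G.hom] (x : G.left) :
    ∃ (g : 𝟙_ (Over (Spec (.of k))) ⟶ G) (y : (𝟙_ (Over (Spec (.of k)))).left), g.left y = x := by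
  have hx : IsClosed ({x} : Set G.left) := isClosed_singleton_of_isFinite G.hom x
  refine ⟨Over.homMk (pointOfClosedPoint G.hom x hx) (by simp), IsLocalRing.closedPoint k, ?_⟩
  exact pointOfClosedPoint_apply G.hom x hx _

/-- If the unit section `η.left : Spec k → G` of a group scheme over a field is an OPEN immersion, then so is
every `k`-point `g : Spec k → G` — it is the unit section followed by the translation automorphism `τ_g`
(`exists_iso_left_one_comp_eq`). [cite: Tate1997FiniteFlatGroupSchemes, (3.7)] -/
theorem isOpenImmersion_left_of_isOpenImmersion_one_left [GrpObj G]
    [IsOpenImmersion (η[G] : 𝟙_ (Over (Spec (.of k))) ⟶ G).left] (g : 𝟙_ (Over (Spec (.of k))) ⟶ G) :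
    IsOpenImmersion g.left := by
  obtain ⟨τ, hτ, -⟩ := exists_iso_left_one_comp_eq G g
  rw [← hτ]
  infer_instance

/-- **A finite group scheme over an algebraically closed field whose unit section is an open immersion is
ÉTALE.**  The `k`-points `g.left : Spec k → G` are open immersions (translates of the unit section) and cover
`G` (every point is rational), and on each the structure map restricts to the isomorphism `Spec k → Spec k`;
étaleness is Zariski-local on the source. [cite: Tate1997FiniteFlatGroupSchemes, (3.7)] -/
theorem etale_of_isOpenImmersion_one_left [IsAlgClosed k] [GrpObj G] [IsFinite G.hom]
    [IsOpenImmersion (η[G] : 𝟙_ (Over (Spec (.of k))) ⟶ G).left] : Etale G.hom := by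
  haveI := fun g : 𝟙_ (Over (Spec (.of k))) ⟶ G => isOpenImmersion_left_of_isOpenImmersion_one_left G g
  let 𝒰 : G.left.OpenCover :=
    Scheme.Cover.mkOfCovers (𝟙_ (Over (Spec (.of k))) ⟶ G) (fun _ => (𝟙_ (Over (Spec (.of k)))).left)
      (fun g => g.left) (fun x => exists_hom_left_apply_eq G x)
  refine IsZariskiLocalAtSource.of_openCover (P := @Etale) 𝒰 fun g => ?_
  change Etale ((g : 𝟙_ (Over (Spec (.of k))) ⟶ G).left ≫ G.hom)
  rw [Over.w g]
  change Etale (𝟙 (Spec (.of k)))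
  infer_instance

/-- **The number of `k`-points of a finite étale group scheme over `k = k̄` is its rank**
`|G(k)| = dim_k Γ(G, 𝒪_G)` (★ `Motives.natCard_specHom_eq_finrank`: a finite étale scheme over a separably
closed field is split). [cite: StacksProject, Tag 00U3] [cite: Tate1997FiniteFlatGroupSchemes, (3.7)] -/
theorem natCard_hom_eq_finrank_of_etale [IsAlgClosed k] [IsFinite G.hom] [Etale G.hom] :
    Nat.card (𝟙_ (Over (Spec (.of k))) ⟶ G) =
      letI := (Motives.algebraMapΓ G.hom).hom.toAlgebra; Module.finrank k Γ(G.left, ⊤) := by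
  haveI : IsAffine G.left := isAffine_of_isAffineHom G.hom
  have h0 : Spec.map (CommRingCat.ofHom (algebraMap k k)) = 𝟙 (Spec (.of k)) := by
    rw [Algebra.algebraMap_self, CommRingCat.ofHom_id, Spec.map_id]
  have e : (𝟙_ (Over (Spec (.of k))) ⟶ G) ≃
      {x : Spec (.of k) ⟶ G.left // x ≫ G.hom = Spec.map (CommRingCat.ofHom (algebraMap k k))} :=
    { toFun := fun g => ⟨g.left, (Over.w g).trans h0.symm⟩
      invFun := fun x => Over.homMk x.1 (x.2.trans h0)
      left_inv := fun g => by ext; rfl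
      right_inv := fun x => rfl }
  rw [Nat.card_congr e]
  exact Motives.natCard_specHom_eq_finrank G.hom k

end Field

/-! ## §3 The `IsUnitComponent` form: trivial unit component ⟹ étale, with the point count -/

section UnitComponent

variable {k : Type u} [Field k]

/-- If `j : G₀ ↪ G` is a homomorphism whose underlying map is an open immersion and `G₀ → Spec k` is an
ISOMORPHISM (the unit component is the reduced point), then the unit section `η[G].left = η[G₀].left ≫ j.left`
is an open immersion. [cite: Tate1997FiniteFlatGroupSchemes, (3.7)] -/
theorem isOpenImmersion_one_left_of_isIso_hom (G G₀ : Over (Spec (.of k))) [GrpObj G] [GrpObj G₀]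
    (j : G₀ ⟶ G) [IsMonHom j] [IsOpenImmersion j.left] [IsIso G₀.hom] :
    IsOpenImmersion (η[G] : 𝟙_ (Over (Spec (.of k))) ⟶ G).left := by
  have h1 : (η[G] : 𝟙_ (Over (Spec (.of k))) ⟶ G) = η[G₀] ≫ j := (IsMonHom.one_hom j).symm
  have h2 : IsIso ((η[G₀] : 𝟙_ (Over (Spec (.of k))) ⟶ G₀).left ≫ G₀.hom) := by
    rw [Over.w]; change IsIso (𝟙 (Spec (.of k))); infer_instance
  haveI : IsIso (η[G₀] : 𝟙_ (Over (Spec (.of k))) ⟶ G₀).left := IsIso.of_isIso_comp_right _ G₀.hom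
  rw [h1, Over.comp_left]
  infer_instance

/-- **(b1f) TRIVIAL UNIT COMPONENT ⟹ ÉTALE, with the point count.**  Let `k` be an algebraically closed field,
`G` a FINITE group scheme over `k` and `j : G₀ ⟶ G` a unit component in the sense of the P6b line
`F0_P6b_ConnectedEtale` (`IsUnitComponent G G₀ j`: `j` a homomorphism whose underlying morphism is an open
and closed immersion, `G₀.left` connected) such that `G₀ → Spec k` is an ISOMORPHISM (`G⁰ = Spec k`).  Then
`G → Spec k` is ÉTALE and the number of `k`-points of `G` (`= sections 𝟙 ⟶ G`) equals the rank
`dim_k Γ(G, 𝒪_G)` — i.e. `G` is the constant group scheme on `G(k)`.  (Only `IsMonHom j`, `IsOpenImmersion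
j.left` and `IsIso G₀.hom` are used; the other two clauses are carried for the socket's shape.)
[cite: Tate1997FiniteFlatGroupSchemes, (3.7)] [cite: StacksProject, Tag 00U3] -/
theorem etale_and_natCard_eq_of_isUnitComponent_of_isIso :
    ∀ (k : Type u) [Field k] [IsAlgClosed k] (G G₀ : Over (Spec (.of k))) [GrpObj G] [GrpObj G₀]
      (j : G₀ ⟶ G), IsFinite G.hom →
      (IsMonHom j ∧ IsOpenImmersion j.left ∧ IsClosedImmersion j.left ∧ ConnectedSpace G₀.left) →
      IsIso G₀.hom →
        Etale G.hom ∧ Nat.card (𝟙_ (Over (Spec (.of k))) ⟶ G) =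
          letI := (Motives.algebraMapΓ G.hom).hom.toAlgebra; Module.finrank k Γ(G.left, ⊤) := by
  intro k _ _ G G₀ _ _ j hG hj hG₀
  obtain ⟨hmon, hop, -, -⟩ := hj
  haveI := hG; haveI := hmon; haveI := hop; haveI := hG₀
  haveI := isOpenImmersion_one_left_of_isIso_hom G G₀ j
  haveI := etale_of_isOpenImmersion_one_left G
  exact ⟨inferInstance, natCard_hom_eq_finrank_of_etale G⟩

end UnitComponent

/-! ## §4 (ED. 2) The rank-one form: a unit component presented by a `k`-algebra of dimension `1` -/

section RankOne

variable {k : Type u} [Field k]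

/-- **A finite `k`-scheme presented by a `k`-algebra of dimension one is `Spec k`**: if `e : X ≅ Spec B₀` over
`k` with `dim_k B₀ = 1`, then the structure map `X → Spec k` is an isomorphism (a finite flat morphism of rank
`1` is an isomorphism, Mathlib `Scheme.Hom.isIso_iff_finrank_eq`; the rank of `Spec B₀ → Spec k` is
`Module.rankAtStalk B₀ = finrank_k B₀`).  This converts the COUNT currency of the P6b line (`stub_b1cg`:
`rank G = #G(k) · rank G⁰` with coordinate rings presented by `eB`, `eB₀`) into the hypothesis `IsIso G₀.hom`
of `etale_and_natCard_eq_of_isUnitComponent_of_isIso`. [cite: StacksProject, Tag 02KA] -/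
theorem isIso_hom_of_finrank_eq_one (X : Over (Spec (.of k))) (B₀ : Type u) [CommRing B₀] [Algebra k B₀]
    (eB₀ : X.left ≅ Spec (.of B₀))
    (heB₀ : eB₀.hom ≫ Spec.map (CommRingCat.ofHom (algebraMap k B₀)) = X.hom)
    (h1 : Module.finrank k B₀ = 1) : IsIso X.hom := by
  haveI : Module.Finite k B₀ := Module.finite_of_finrank_pos (by rw [h1]; exact Nat.one_pos)
  have hfin : (CommRingCat.ofHom (algebraMap k B₀)).hom.Finite := by
    simpa [RingHom.finite_algebraMap] using (inferInstance : Module.Finite k B₀)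
  have hfl : (CommRingCat.ofHom (algebraMap k B₀)).hom.Flat := by
    simpa [RingHom.flat_algebraMap_iff] using (inferInstance : Module.Flat k B₀)
  haveI : IsFinite (Spec.map (CommRingCat.ofHom (algebraMap k B₀))) := (IsFinite.SpecMap_iff _).mpr hfin
  haveI : Flat (Spec.map (CommRingCat.ofHom (algebraMap k B₀))) := Flat.SpecMap_iff.mpr hfl
  haveI : IsIso (Spec.map (CommRingCat.ofHom (algebraMap k B₀))) := by
    rw [Scheme.Hom.isIso_iff_finrank_eq]
    funext x
    rw [Scheme.Hom.finrank_SpecMap_algebraMap, Module.rankAtStalk_eq_finrank_of_free, h1]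
    rfl
  rw [← heB₀]
  infer_instance

/-- **(b1f), RANK-ONE FORM.**  Let `k` be an algebraically closed field, `G` a finite group scheme over `k`,
`j : G₀ ⟶ G` a unit component (`IsUnitComponent G G₀ j` of the P6b line, clauses spelled out) whose
coordinate ring — presented as in the P6b count `stub_b1cg` by `eB₀ : G₀.left ≅ Spec B₀` over `k` — has
`dim_k B₀ = 1` (e.g. read off `rank G = #G(k) · rank G⁰`).  Then `G → Spec k` is ÉTALE and
`#(𝟙 ⟶ G) = dim_k Γ(G, 𝒪_G)`. [cite: Tate1997FiniteFlatGroupSchemes, (3.7)] [cite: StacksProject, Tag 00U3] -/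
theorem etale_and_natCard_eq_of_isUnitComponent_of_finrank_eq_one :
    ∀ (k : Type u) [Field k] [IsAlgClosed k] (G G₀ : Over (Spec (.of k))) [GrpObj G] [GrpObj G₀]
      (j : G₀ ⟶ G), IsFinite G.hom →
      (IsMonHom j ∧ IsOpenImmersion j.left ∧ IsClosedImmersion j.left ∧ ConnectedSpace G₀.left) →
      ∀ (B₀ : Type u) [CommRing B₀] [Algebra k B₀] (eB₀ : G₀.left ≅ Spec (.of B₀)),
        eB₀.hom ≫ Spec.map (CommRingCat.ofHom (algebraMap k B₀)) = G₀.hom →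
        Module.finrank k B₀ = 1 →
          Etale G.hom ∧ Nat.card (𝟙_ (Over (Spec (.of k))) ⟶ G) =
            letI := (Motives.algebraMapΓ G.hom).hom.toAlgebra; Module.finrank k Γ(G.left, ⊤) := by
  intro k _ _ G G₀ _ _ j hG hj B₀ _ _ eB₀ heB₀ h1
  exact etale_and_natCard_eq_of_isUnitComponent_of_isIso k G G₀ j hG hj
    (isIso_hom_of_finrank_eq_one G₀ B₀ eB₀ heB₀ h1)

end RankOne

/-! ## §5 (ED. 3) One rational point ⟹ connected (organ μ3 of the DICT constructor, LEAD M-6c) -/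

section OnePoint

variable {k : Type u} [Field k] [IsAlgClosed k]

/-- Over an algebraically closed field the underlying space of a FINITE `k`-scheme has at most as many points as
`k`-points: if the sections `𝟙 ⟶ X` form a subsingleton, so does the carrier of `X` (every point is the image of
a `k`-point, `exists_hom_left_apply_eq`, and `Spec k` has one point). [cite: StacksProject, Tag 00U3] -/
theorem subsingleton_left_of_subsingleton_hom (X : Over (Spec (.of k))) [IsFinite X.hom]
    [Subsingleton (𝟙_ (Over (Spec (.of k))) ⟶ X)] : Subsingleton ↥X.left := by
  haveI : Subsingleton ↥(𝟙_ (Over (Spec (.of k)))).left :=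
    inferInstanceAs (Subsingleton (PrimeSpectrum k))
  refine ⟨fun a b => ?_⟩
  obtain ⟨g, y, rfl⟩ := exists_hom_left_apply_eq X a
  obtain ⟨g', y', rfl⟩ := exists_hom_left_apply_eq X b
  rw [Subsingleton.elim g g', Subsingleton.elim y y']

/-- **(μ3) ONE `k`-POINT ⟹ CONNECTED.**  Let `k` be algebraically closed and `X → Spec k` FINITE with exactly one
section `𝟙 ⟶ X` (one `k`-point; e.g. `#H(κ̄) = 1` for a finite group scheme `H`).  Then the underlying space of `X`
is connected (indeed a single point).  DICT use ((E-b), branch `H(κ̄) = 0`): such an `H ↪ G` is connected, hence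
factors through the unit component (★ `ConnectedFactorsThroughUnitComponent.existsUnique_fac_hom`).
[cite: Tate1997FiniteFlatGroupSchemes, (3.7)] [cite: StacksProject, Tag 00U3] -/
theorem connectedSpace_left_of_natCard_hom_eq_one :
    ∀ (k : Type u) [Field k] [IsAlgClosed k] (X : Over (Spec (.of k))), IsFinite X.hom →
      Nat.card (𝟙_ (Over (Spec (.of k))) ⟶ X) = 1 → ConnectedSpace ↥X.left := by
  intro k _ _ X hX h1
  obtain ⟨hs, ⟨g₀⟩⟩ := Nat.card_eq_one_iff_unique.mp h1
  haveI : Subsingleton ↥X.left := subsingleton_left_of_subsingleton_hom X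
  haveI : Nonempty ↥X.left := ⟨g₀.left (IsLocalRing.closedPoint k)⟩
  exact { isPreconnected_univ := Set.subsingleton_univ.isPreconnected, toNonempty := inferInstance }

end OnePoint

end Literature.AlgebraicGeometry.GroupSchemes
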